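import Literature.MathematicalPhysics.QuantumFieldTheory.Balaban1983to89.B9SectBStepsUParG
import Literature.MathematicalPhysics.QuantumFieldTheory.Balaban1983to89.B9SectBL2GFrameSelY

/-!
# `Balaban1983to89.B9SectBStepUParGOfMembers` — T. Bałaban, *Propagators for lattice gauge theories in a background field*, Commun. Math. Phys. **99** (1985)
# 389–434 [Balaban1985BackgroundPropagators], Thm 3.4 p. 400, Sect. B pp. 400–407 (p. 407: «Thus Theorem 3.4 is proved, assuming that Theorems 3.1–3.3 hold»),
# (3.21) p. 394, (3.40) p. 397, (3.35)–(3.37) p. 396: ★★★ THE ROW-13 STEP OF RECORD WITH THE TWO TRANSPORTER ROLES SEPARATED AND THE AVERAGING-TRANSPORTER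
# LAWS GUARDED BY (3.35) — `sectBStepUParG_of_members` (pub-ymgap N06 [B9]; CASCADE-K K1; cure (α) of ⚑ LOCATED-29, module S5 — the junction)

statement-level skeleton of published theorems with citation tags; proofs where landed; nothing here is a claim about the Yang–Mills mass gap

THE PRINT.  Sect. B proves Theorem 3.4 (the bounds (3.42)–(3.48) for `G′(U′U)`, `(Q′G′²Q′*)⁻¹(U′U)`, `G(U′U)` from those at `U`) for `U` in (3.35) and `U′` in
(3.37); every use of the averaging operators (3.21) and of Theorem 3.11 is at such configurations.

WHY THIS FILE (director-ym №383 CASCADE-K, seat dag-n06-c; ⚑ LOCATED-29 «the displayed laws `hpar ∕ hunit ∕ hunitX` of `sectBStepUPar_of_members` are not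
inhabitable at `parA := parKnitY` off the (3.35)∕(52) regime»; node00-def-Y RULING (α) «guard the three displayed transporter laws by print's class»; INTENT-8 GO,
design point (c1)).  THIS FILE is module F5 (`B9SectBStepUParHOfMembers`) re-assembled on the guarded members of module S4 (`B9SectBStepsUParG`) and the guarded
G-side frames of S2∕S3 (`B9SectBGFramesSelY`, `B9SectBL2GFrameSelY`): the SAME conclusion `SectBStepUPar P f (d+1) c35 G b parA parH (GAY … parA parBY (GpY parA))
parBY C37 C38 (CinvY P f G parA)` from the same sixteen members, with the averaging-transporter laws now displayed GUARDED —
`hparG : ∀ j α₀ U, MInv ≤ M_j → 0 < α₀ → M_j·α₀ ≤ aInv → (bg9YC 𝔸 G P (f j)).Reg335 c35 α₀ U → ∀ z w, parA j U z w ∈ G`, `hunitG`, `hunitXG` (same guard;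
def-Y's spec shape, `aK := aInv`), `hparC : ∀ j β U a, C37 j β U a → ∀ z w, parA j U z w ∈ G` (design point (c1)), `hsym` unguarded as before.  At
`parA := parKnitY` these are inhabited by `parKnitY_mem_…_of_reg335P` ∕ `isUnit_deltaPrimeAY_parKnitY` ∕ `isUnit_XY_parKnitY` under the certificate's regime
(node00-def-Y I.19802 (ii)); at `parSymY` by the record's unconditional laws.

CONTENTS.  §1 the six G-side members through the `…Sel` frames re-keyed to `KSC₇Par` (`step…_KACU_frameParG_on`); §2 ★★★ `sectBStepUParG_of_members`, `thm34UParG_of_members`;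
§3 `sectBStepUParG_parSymYH_of_members` (`parH := parSymY`, Hölder laws discharged).

HONEST SCOPE.  Assembly bookkeeping; every member is S4's ∕ the `…Sel` frames'; nothing of [B9] asserted beyond F5's displayed hypotheses (three of them now weaker);
the (3.48)∕Thm 3.2∕3.3 inputs `h32 ∕ h33` displayed as in F5; COUNT-NEUTRAL; N06 NOT discharged; one finite lattice programme — nothing continuum ∕ OS ∕ mass-gap ∕ Clay.
Cell `pub-ymgap` (HUMAN RULING D-0062), Track A node N06 [B9], CASCADE-K (№383), cure (α) of LOCATED-29, module S5.

RELATED IN THE TREE, NOT DUPLICATED: `B9SectBStepUParHOfMembers` (F5: the unguarded junction and `stepPos_KSCUPar_of_KSC₇Par`, USED BY NAME), `B9SectBStepsUParG` (S4),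
`B9SectBGFramesSelY` ∕ `B9SectBL2GFrameSelY` (S2∕S3), `B9SectBFrameGpSwap` (`swapGp`), `B9SectBStepWhole` (`sectBStepPrinted_of_posBlockSteps`), `B9SectBCodedReadingsUParH`
(`SectBStepUPar`, `Thm34UPar`) — USED BY NAME; no existing module modified.
-/

noncomputable section

namespace Literature.MathematicalPhysics.QuantumFieldTheory.Balaban1983to89.B9SectBStepUParGOfMembers

open Literature.MathematicalPhysics.QuantumFieldTheory.Balaban1983to89.B9SectBCodedClassR (RegExtraY bg9YC)
open Literature.MathematicalPhysics.QuantumFieldTheory.Balaban1983to89.B9SectBStepUOfMembersR (thm32Printed_codedU)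
open Literature.MathematicalPhysics.QuantumFieldTheory.Balaban1983to89.B9SectBCodedFamiliesUParH
open B6Ineq2142KLevelV1 (β)
open B6RandomWalk (Ineq261)
open B9Thm34Ext (toB6)
open B9FromB6 (EBlock L2Block GlobBlock)
open B9PinMembersKLevelV1 (MemberY geo9Y bg9Y)
open B9Eq360DeltaPrimeAY (AfldY)
open B9SectBGpLettersY (GVal)
open B9SectBGpFrameCodedYR (codingYx)
open B9SectBGpFrameCodedY (CplxLettersY)
open B9SectBGpReadingsYR (KSC)
open B9SectBCodedCarrier (CCfg pullK pullS thm32Printed_coded thm33Printed_coded)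
open B9SectBCodedReadingsUR (KSCU KACU SectBStepU Thm34U)
open B9SectBCodedReadingsUParH (KSCUPar SectBStepUPar Thm34UPar)
open B9SectBCodedChainAnR (IsAnKY)
open B9SectBKerFrameCodedYR (CinvY)
open B9SectBStepWhole (StepPos StepEPos StepGlobPos StepL2Pos StepH1Pos StepE4Pos StepH2Pos StepKerPos StepAnalyticPos sectBStepPrinted_of_posBlockSteps)
open B9SectBStepPosFamilyTransfer (stepPos_of_family_pos stepPos_blk_of_family_pos)
open B9RWSumsReadsNbr (nbr)
open B9SectBGClassLettersY (Reg335PlaqY CplxLettersGY VarParBY)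
open B9SectBGStepCodedFGlobR (globBlock_KACU_prod_of_eBlock globBlock_mono_const)
open B9Eq340HolderLipParBYR (hLipB_parBY)
open B9Eq340HolderLipParBY (hparB_parBY)
open B9Eq340TaxiContourLocalityY (rLB rLB_nonneg)
open B9SectBL2GFrameCodedY (Read377L2)
open B9SectBL2SecondOrderY (PlaqLawY)
open B9SectBGFrameV5 (stepEPos_of_gFrame₅)
open B9SectBH1GFrameV6 (stepH1Pos_of_h1GFrame₆)
open B9SectBE4H2GFrameV6 (stepE4Pos_of_e4h2GFrame₆ stepH2Pos_of_e4h2GFrame₆)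
open B9SectBL2GFrameV8 (stepL2Pos_of_l2GFrame₈)
open B9SectBH1ProbesY (HolderLipY)
open B9Eq340HolderLipParSymYR (hLip_parSymY)
open B9GeoNormsKLevelModelSignsV1 (modelSignsOn_geo9K)
open Node00 (SiteY BlkY FBondY IBondY CfgY SiteParY BondParY BondOpY GAY GpY XY deltaAY deltaPrimeAY parSymY parBY parSymY_inv_symm parSymY_mem kernelFamilyS kernelFamilyB)

open Literature.MathematicalPhysics.QuantumFieldTheory.Balaban1983to89.B9SectBParSelY
open Literature.MathematicalPhysics.QuantumFieldTheory.Balaban1983to89.B9SectBFramesSelY (gpFrame₂CodedOnSel anFrame₂CodedOnSel cinvFrame₃CodedOnSel e4Frame₃CodedOnSel)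
open Literature.MathematicalPhysics.QuantumFieldTheory.Balaban1983to89.B9SectBGFramesSelY (gFrame₅CodedOnSel h1GFrame₆CodedOnSel e4h2GFrame₆CodedOnSel)
open Literature.MathematicalPhysics.QuantumFieldTheory.Balaban1983to89.B9SectBL2GFrameSelY (l2GFrame₈CodedOnSel read377L2_gFrame₅CodedOnSel)
open Literature.MathematicalPhysics.QuantumFieldTheory.Balaban1983to89.B9SectBStepsUParG
open Literature.MathematicalPhysics.QuantumFieldTheory.Balaban1983to89.B9SectBStepUParHOfMembers (stepPos_KSCUPar_of_KSC₇Par)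

variable {d ℓ : ℕ} {hd : 1 ≤ d + 1} {hL : Odd (ℓ + 1) ∧ 1 < ℓ + 1} {b₀ b₁ : ℝ} {Mstar : ℕ}

variable {𝔸 : Type} [NormedRing 𝔸] (P : RegExtraY d ℓ hd hL b₀ b₁ Mstar 𝔸) [NormedAlgebra ℂ 𝔸] [CompleteSpace 𝔸] [NormOneClass 𝔸] [FiniteDimensional ℝ 𝔸]
  {J : Type} (f : J → MemberY d ℓ hd hL b₀ b₁ Mstar) [∀ x : MemberY d ℓ hd hL b₀ b₁ Mstar, Fintype (geo9Y x).Site]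
  [instDS : ∀ x : MemberY d ℓ hd hL b₀ b₁ Mstar, DecidableEq (geo9Y x).Site] [instNE : ∀ x : MemberY d ℓ hd hL b₀ b₁ Mstar, Nonempty (geo9Y x).Site]
  (c35 : ℝ) (G : Subgroup 𝔸ˣ) {ι : Type} [Fintype ι] [DecidableEq ι] (b : Module.Basis ι ℝ 𝔸)
  (ιB : ∀ j : J, BlkY (f j).toKIdx → IBondY (f j).toKIdx)
  (C38 : ∀ j : J, ℝ → CfgY 𝔸 (f j).toKIdx → AfldY 𝔸 (f j).toKIdx → Prop)
  (parA parH : ∀ j : J, SiteParY 𝔸 (f j).toKIdx) (C37 : ∀ j : J, ℝ → CfgY 𝔸 (f j).toKIdx → AfldY 𝔸 (f j).toKIdx → Prop)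

/-! ## §1 The input transfer `KSC₇Par ⟶ KSCUPar` and the six G-side members with G′-input `KSC₇Par` -/

section GSide

variable (OA : ∀ j : J, BondOpY 𝔸 (f j).toKIdx) (parB : ∀ j : J, BondParY 𝔸 (f j).toKIdx) (Cinv : ∀ j : J, B9.SiteKernel (geo9Y (f j)) (bg9YC 𝔸 G P (f j)))

/-- ★ **THE (3.42) MEMBER OF THE BOND FAMILY `KACU` THROUGH THE RE-KEYED G FRAME** (G′-input `KSC₇Par parA parH`): `stepEPos_of_gFrame₅` on the record's guarded frame
`B9SectBGFrameCodedYRG.gFrame₅CodedOn` AT `parA` (bond transporter `parBY`, `hparB := hparB_parBY`) re-keyed by `GFrame₅.swapGp`.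
[cite: Balaban1985BackgroundPropagators, Thm 3.4 p.400, Thm 3.3 p.399, (3.42) p.397, (3.82)–(3.86) p.407; Balaban1984PropagatorsII, Lemma 2.1 p.234, (2.51) p.232] -/
theorem stepEPos_KACU_frameParG_on (hι : ∀ (j : J) (s : BlkY (f j).toKIdx), β (f j).toKIdx.hN (f j).toKIdx.D (f j).toKIdx.hk (ιB j s) = s)
    (hG1 : ∀ u : 𝔸ˣ, u ∈ G → ‖(u : 𝔸)‖ ≤ 1)
    (M₂ : ℝ) (hM₂ : 0 ≤ M₂) (hrepr : ∀ (v : 𝔸) (j : ι), |b.repr v j| ≤ M₂ * ‖v‖) (hcR : 0 < M₂ * ∑ j, ‖b j‖)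
    (Cq : ℝ) (hCq : 0 ≤ Cq) (hC37 : ∀ j β' U a, C37 j β' U a → GVal G (f j).toKIdx U ∧ CplxLettersY G (f j) (parA j) (ιB j) Cq β' U a)
    (MInv aInv aW : ℝ) (hMInv : 0 < MInv) (haInv : 0 < aInv) (haW : 0 < aW)
    (hparG : ∀ j (α₀ : ℝ) (U : CfgY 𝔸 (f j).toKIdx), MInv ≤ (geo9Y (f j)).M → 0 < α₀ → (geo9Y (f j)).M * α₀ ≤ aInv →
      (bg9YC 𝔸 G P (f j)).Reg335 c35 α₀ U → ∀ z w, parA j U z w ∈ G)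
    (hparC : ∀ j β' U a, C37 j β' U a → ∀ z w, parA j U z w ∈ G)
    (hunitG : ∀ j (α₀ : ℝ) (U : CfgY 𝔸 (f j).toKIdx), MInv ≤ (geo9Y (f j)).M → 0 < α₀ → (geo9Y (f j)).M * α₀ ≤ aInv →
      (bg9YC 𝔸 G P (f j)).Reg335 c35 α₀ U → IsUnit (deltaPrimeAY (f j).toKIdx (parA j) U))
    (hunitXG : ∀ j (α₀ : ℝ) (U : CfgY 𝔸 (f j).toKIdx), MInv ≤ (geo9Y (f j)).M → 0 < α₀ → (geo9Y (f j)).M * α₀ ≤ aInv →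
      (bg9YC 𝔸 G P (f j)).Reg335 c35 α₀ U → IsUnit (XY (f j).toKIdx (parA j) (GpY (f j).toKIdx (parA j)) U))
    (hsym : ∀ j (U : CfgY 𝔸 (f j).toKIdx) (z w : SiteY (f j).toKIdx), parA j U z w = (parA j U w z)⁻¹)
    (hunitA : ∀ j (α₀ : ℝ) (U : CfgY 𝔸 (f j).toKIdx), MInv ≤ (geo9Y (f j)).M → 0 < α₀ → (geo9Y (f j)).M * α₀ ≤ aInv →
      (bg9YC 𝔸 G P (f j)).Reg335 c35 α₀ U →
      IsUnit (deltaAY (f j).toKIdx (parA j) (parBY (f j).toKIdx) (GpY (f j).toKIdx (parA j)) U)) (hb₁ : 0 ≤ b₁)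
    (C₀ : ℝ) (hC₀ : 0 ≤ C₀)
    (hreg335P : ∀ j (α₀ : ℝ) (U : CfgY 𝔸 (f j).toKIdx), MInv ≤ (geo9Y (f j)).M → 0 < α₀ → (geo9Y (f j)).M * α₀ ≤ aInv →
      (bg9YC 𝔸 G P (f j)).Reg335 c35 α₀ U → Reg335PlaqY G (f j) (ιB j) C₀ U)
    (hC37G : ∀ j β' U a, C37 j β' U a → CplxLettersGY G (f j) (ιB j) β' U a)
    (cVar : ℝ) (hcVar : 0 ≤ cVar) (hvarB : ∀ j β' U a, C37 j β' U a → VarParBY (f j).toKIdx (parBY (f j).toKIdx) cVar β' U a)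
    (hMd : 2 * ((d : ℝ) + 1) < MInv) (mN : ℕ) (hnbr : ∀ (j : J) (y' : IBondY (f j).toKIdx), (nbr (geo9Y (f j)) (2 * ((d : ℝ) + 1)) y').card ≤ mN)
    (d261 : ℝ → ℕ)
    (h261 : ∀ (j : J) (δ α : ℝ), 0 < δ → δ ≤ 1 → 9 / 5000 ≤ α → α < 1 →
      (gFrame₅CodedOnSel P f c35 G parA (fun j => parBY (f j).toKIdx) b ιB C37 C38 hι hG1 M₂ hM₂ hrepr hcR Cq hCq hC37 MInv aInv aW hMInv haInv haW hparG hparC hunitG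
        hunitXG hsym hunitA (hparB_parBY f G) hb₁ C₀ hC₀ hreg335P hC37G cVar hcVar hvarB hMd mN hnbr).M261 δ ≤ (geo9Y (f j)).M →
      Ineq261 (d261 δ) (toB6 (geo9Y (f j)) 0 True) δ α) :
    StepEPos (d + 1) c35 (fun j => geo9Y (f j)) (fun j => (codingYx P G (f j) (C37 j) (C38 j)).bg) (fun j => KSC₇Par P G (f j) (parA j) (parH j) (C37 j) (C38 j))
      (fun j => KACU P G (f j) (GAY (f j).toKIdx (parA j) (parBY (f j).toKIdx) (GpY (f j).toKIdx (parA j))) (parBY (f j).toKIdx) (C37 j) (C38 j))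
      (fun j => pullS (codingYx P G (f j) (C37 j) (C38 j)) (CinvY P f G parA j))
      (fun j => KACU P G (f j) (GAY (f j).toKIdx (parA j) (parBY (f j).toKIdx) (GpY (f j).toKIdx (parA j))) (parBY (f j).toKIdx) (C37 j) (C38 j)) :=
  stepEPos_of_gFrame₅ (F := (gFrame₅CodedOnSel P f c35 G parA (fun j => parBY (f j).toKIdx) b ιB C37 C38 hι hG1 M₂ hM₂ hrepr hcR Cq hCq hC37 MInv aInv aW hMInv haInv haW hparG hparC hunitG hunitXG hsym hunitA
        (hparB_parBY f G) hb₁ C₀ hC₀ hreg335P hC37G cVar hcVar hvarB hMd mN hnbr).swapGp (fun j => KSC₇Par P G (f j) (parA j) (parH j) (C37 j) (C38 j))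
      (fun j _ _ c => eBlock_KSC₇Par_iff P G (f j) (parA j) (parH j) (C37 j) (C38 j) c)) d261 h261

/-- ★ **THE (3.47) MEMBER OF `KACU` THROUGH THE RE-KEYED G FRAME**: §1's (3.42) step followed at every coded product by dag-n06-c's «(3.42) block ⟹ (3.47) block»
(`globBlock_KACU_prod_of_eBlock`, [4] Lemma 2.1) — `B9SectBStepUGuardedR.stepGlobPos_KACU_frame_on`'s proof verbatim.
[cite: Balaban1985BackgroundPropagators, Thm 3.4 p.400, (3.47) p.398, (3.82)–(3.86) p.407; Balaban1984PropagatorsII, Lemma 2.1 p.234, (2.51) p.232] -/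
theorem stepGlobPos_KACU_frameParG_on (hι : ∀ (j : J) (s : BlkY (f j).toKIdx), β (f j).toKIdx.hN (f j).toKIdx.D (f j).toKIdx.hk (ιB j s) = s)
    (hG1 : ∀ u : 𝔸ˣ, u ∈ G → ‖(u : 𝔸)‖ ≤ 1)
    (M₂ : ℝ) (hM₂ : 0 ≤ M₂) (hrepr : ∀ (v : 𝔸) (j : ι), |b.repr v j| ≤ M₂ * ‖v‖) (hcR : 0 < M₂ * ∑ j, ‖b j‖)
    (Cq : ℝ) (hCq : 0 ≤ Cq) (hC37 : ∀ j β' U a, C37 j β' U a → GVal G (f j).toKIdx U ∧ CplxLettersY G (f j) (parA j) (ιB j) Cq β' U a)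
    (MInv aInv aW : ℝ) (hMInv : 0 < MInv) (haInv : 0 < aInv) (haW : 0 < aW)
    (hparG : ∀ j (α₀ : ℝ) (U : CfgY 𝔸 (f j).toKIdx), MInv ≤ (geo9Y (f j)).M → 0 < α₀ → (geo9Y (f j)).M * α₀ ≤ aInv →
      (bg9YC 𝔸 G P (f j)).Reg335 c35 α₀ U → ∀ z w, parA j U z w ∈ G)
    (hparC : ∀ j β' U a, C37 j β' U a → ∀ z w, parA j U z w ∈ G)
    (hunitG : ∀ j (α₀ : ℝ) (U : CfgY 𝔸 (f j).toKIdx), MInv ≤ (geo9Y (f j)).M → 0 < α₀ → (geo9Y (f j)).M * α₀ ≤ aInv →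
      (bg9YC 𝔸 G P (f j)).Reg335 c35 α₀ U → IsUnit (deltaPrimeAY (f j).toKIdx (parA j) U))
    (hunitXG : ∀ j (α₀ : ℝ) (U : CfgY 𝔸 (f j).toKIdx), MInv ≤ (geo9Y (f j)).M → 0 < α₀ → (geo9Y (f j)).M * α₀ ≤ aInv →
      (bg9YC 𝔸 G P (f j)).Reg335 c35 α₀ U → IsUnit (XY (f j).toKIdx (parA j) (GpY (f j).toKIdx (parA j)) U))
    (hsym : ∀ j (U : CfgY 𝔸 (f j).toKIdx) (z w : SiteY (f j).toKIdx), parA j U z w = (parA j U w z)⁻¹)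
    (hunitA : ∀ j (α₀ : ℝ) (U : CfgY 𝔸 (f j).toKIdx), MInv ≤ (geo9Y (f j)).M → 0 < α₀ → (geo9Y (f j)).M * α₀ ≤ aInv →
      (bg9YC 𝔸 G P (f j)).Reg335 c35 α₀ U →
      IsUnit (deltaAY (f j).toKIdx (parA j) (parBY (f j).toKIdx) (GpY (f j).toKIdx (parA j)) U)) (hb₁ : 0 ≤ b₁)
    (C₀ : ℝ) (hC₀ : 0 ≤ C₀)
    (hreg335P : ∀ j (α₀ : ℝ) (U : CfgY 𝔸 (f j).toKIdx), MInv ≤ (geo9Y (f j)).M → 0 < α₀ → (geo9Y (f j)).M * α₀ ≤ aInv →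
      (bg9YC 𝔸 G P (f j)).Reg335 c35 α₀ U → Reg335PlaqY G (f j) (ιB j) C₀ U)
    (hC37G : ∀ j β' U a, C37 j β' U a → CplxLettersGY G (f j) (ιB j) β' U a)
    (cVar : ℝ) (hcVar : 0 ≤ cVar) (hvarB : ∀ j β' U a, C37 j β' U a → VarParBY (f j).toKIdx (parBY (f j).toKIdx) cVar β' U a)
    (hMd : 2 * ((d : ℝ) + 1) < MInv) (mN : ℕ) (hnbr : ∀ (j : J) (y' : IBondY (f j).toKIdx), (nbr (geo9Y (f j)) (2 * ((d : ℝ) + 1)) y').card ≤ mN)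
    (d261 : ℝ → ℕ)
    (h261 : ∀ (j : J) (δ α : ℝ), 0 < δ → δ ≤ 1 → 9 / 5000 ≤ α → α < 1 →
      (gFrame₅CodedOnSel P f c35 G parA (fun j => parBY (f j).toKIdx) b ιB C37 C38 hι hG1 M₂ hM₂ hrepr hcR Cq hCq hC37 MInv aInv aW hMInv haInv haW hparG hparC hunitG
        hunitXG hsym hunitA (hparB_parBY f G) hb₁ C₀ hC₀ hreg335P hC37G cVar hcVar hvarB hMd mN hnbr).M261 δ ≤ (geo9Y (f j)).M →
      Ineq261 (d261 δ) (toB6 (geo9Y (f j)) 0 True) δ α) :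
    StepGlobPos (d + 1) c35 (fun j => geo9Y (f j)) (fun j => (codingYx P G (f j) (C37 j) (C38 j)).bg) (fun j => KSC₇Par P G (f j) (parA j) (parH j) (C37 j) (C38 j))
      (fun j => KACU P G (f j) (GAY (f j).toKIdx (parA j) (parBY (f j).toKIdx) (GpY (f j).toKIdx (parA j))) (parBY (f j).toKIdx) (C37 j) (C38 j))
      (fun j => pullS (codingYx P G (f j) (C37 j) (C38 j)) (CinvY P f G parA j))
      (fun j => KACU P G (f j) (GAY (f j).toKIdx (parA j) (parBY (f j).toKIdx) (GpY (f j).toKIdx (parA j))) (parBY (f j).toKIdx) (C37 j) (C38 j)) := by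
  refine stepPos_blk_of_family_pos (d + 1) c35 (fun j => geo9Y (f j)) (fun j => (codingYx P G (f j) (C37 j) (C38 j)).bg)
    (fun j => KSC₇Par P G (f j) (parA j) (parH j) (C37 j) (C38 j)) (fun j => KSC₇Par P G (f j) (parA j) (parH j) (C37 j) (C38 j))
    (fun j => KACU P G (f j) (GAY (f j).toKIdx (parA j) (parBY (f j).toKIdx) (GpY (f j).toKIdx (parA j))) (parBY (f j).toKIdx) (C37 j) (C38 j))
    (fun j => KACU P G (f j) (GAY (f j).toKIdx (parA j) (parBY (f j).toKIdx) (GpY (f j).toKIdx (parA j))) (parBY (f j).toKIdx) (C37 j) (C38 j))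
    (fun j => pullS (codingYx P G (f j) (C37 j) (C38 j)) (CinvY P f G parA j))
    (C₁ := ℝ × ℝ) (C₂ := ℝ) (pos₁ := fun c => 0 < c.1 ∧ 0 < c.2) (pos₂ := fun c => 0 < c)
    (Blk₁ := fun c j W => EBlock (KACU P G (f j) (GAY (f j).toKIdx (parA j) (parBY (f j).toKIdx) (GpY (f j).toKIdx (parA j))) (parBY (f j).toKIdx) (C37 j) (C38 j)) c.1 c.2 W)
    (Blk₂ := fun c j W => GlobBlock (KACU P G (f j) (GAY (f j).toKIdx (parA j) (parBY (f j).toKIdx) (GpY (f j).toKIdx (parA j))) (parBY (f j).toKIdx) (C37 j) (C38 j)) c W)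
    (fun B₀ δ₀ Bβ Bε Bεβ B₁ δ₁ hB₀ hδ₀ hB₁ hδ₁ =>
      ⟨0, 1, B₀, δ₀, Bβ, Bε, Bεβ, B₁, δ₁, one_pos, hB₀, hδ₀, hB₁, hδ₁, fun _ _ _ _ _ _ _ hT => hT⟩)
    (fun c hc a ha => ?_)
    (stepEPos_KACU_frameParG_on P f c35 G b ιB C38 parA parH C37 hι hG1 M₂ hM₂ hrepr hcR Cq hCq hC37 MInv aInv aW hMInv haInv haW hparG hparC hunitG hunitXG hsym hunitA hb₁ C₀ hC₀ hreg335P hC37G cVar hcVar hvarB hMd mN hnbr d261 h261)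
  obtain ⟨Mg, Cg, hCg, H⟩ := globBlock_KACU_prod_of_eBlock P (𝔸 := 𝔸) (d := d) (ℓ := ℓ) (hd := hd) (hL := hL) (b₀ := b₀) (b₁ := b₁) (Mstar := Mstar) G hc.2
  refine ⟨Mg, 1, a, c.1 * (Cg + 1), one_pos, ha, le_rfl, mul_pos hc.1 (by linarith), ?_⟩
  intro j hM α₀ hα₀ _ W hreg α₁ _ _ W' h37 hE
  obtain ⟨U, rfl, -⟩ := (codingYx P G (f j) (C37 j) (C38 j)).exists_of_bg_Reg335 hreg
  obtain ⟨U', a', hcU, rfl, -⟩ := (codingYx P G (f j) (C37 j) (C38 j)).exists_of_bg_Cplx337 h37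
  cases hcU
  have hG := H (f j) (ιB j) (hι j) hM (GAY (f j).toKIdx (parA j) (parBY (f j).toKIdx) (GpY (f j).toKIdx (parA j))) (parBY (f j).toKIdx) (C37 j) (C38 j) U a' c.1 hc.1.le hE
  exact globBlock_mono_const P G (f j) _ (parBY (f j).toKIdx) (C37 j) (C38 j) hG (mul_le_mul_of_nonneg_left (by linarith) hc.1.le)

set_option maxHeartbeats 1600000 in
/-- ★ **THE (3.43) MEMBER OF `KACU` THROUGH THE RE-KEYED G FRAME** (bond transporter `parBY`: `hparB := hparB_parBY`, `hLipB := hLipB_parBY`, `c_LipB = d+1`, `r_L = rLB`):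
`stepH1Pos_of_h1GFrame₆` on `B9SectBH1GFrameCodedYRG.h1GFrame₆CodedOn` AT `parA` re-keyed by `H1GFrame₆.swapGp`.
[cite: Balaban1985BackgroundPropagators, Thm 3.4 p.400, Thm 3.3 p.399, (3.43) p.398, (3.40) p.397; Balaban1984PropagatorsII, Lemma 2.1 p.234, (2.51)–(2.52) p.232] -/
theorem stepH1Pos_KACU_frameParG_on (hι : ∀ (j : J) (s : BlkY (f j).toKIdx), β (f j).toKIdx.hN (f j).toKIdx.D (f j).toKIdx.hk (ιB j s) = s)
    (hG1 : ∀ u : 𝔸ˣ, u ∈ G → ‖(u : 𝔸)‖ ≤ 1)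
    (M₂ : ℝ) (hM₂ : 0 ≤ M₂) (hrepr : ∀ (v : 𝔸) (j : ι), |b.repr v j| ≤ M₂ * ‖v‖) (hcR : 0 < M₂ * ∑ j, ‖b j‖)
    (Cq : ℝ) (hCq : 0 ≤ Cq) (hC37 : ∀ j β' U a, C37 j β' U a → GVal G (f j).toKIdx U ∧ CplxLettersY G (f j) (parA j) (ιB j) Cq β' U a)
    (MInv aInv aW : ℝ) (hMInv : 0 < MInv) (haInv : 0 < aInv) (haW : 0 < aW)
    (hparG : ∀ j (α₀ : ℝ) (U : CfgY 𝔸 (f j).toKIdx), MInv ≤ (geo9Y (f j)).M → 0 < α₀ → (geo9Y (f j)).M * α₀ ≤ aInv →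
      (bg9YC 𝔸 G P (f j)).Reg335 c35 α₀ U → ∀ z w, parA j U z w ∈ G)
    (hparC : ∀ j β' U a, C37 j β' U a → ∀ z w, parA j U z w ∈ G)
    (hunitG : ∀ j (α₀ : ℝ) (U : CfgY 𝔸 (f j).toKIdx), MInv ≤ (geo9Y (f j)).M → 0 < α₀ → (geo9Y (f j)).M * α₀ ≤ aInv →
      (bg9YC 𝔸 G P (f j)).Reg335 c35 α₀ U → IsUnit (deltaPrimeAY (f j).toKIdx (parA j) U))
    (hunitXG : ∀ j (α₀ : ℝ) (U : CfgY 𝔸 (f j).toKIdx), MInv ≤ (geo9Y (f j)).M → 0 < α₀ → (geo9Y (f j)).M * α₀ ≤ aInv →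
      (bg9YC 𝔸 G P (f j)).Reg335 c35 α₀ U → IsUnit (XY (f j).toKIdx (parA j) (GpY (f j).toKIdx (parA j)) U))
    (hsym : ∀ j (U : CfgY 𝔸 (f j).toKIdx) (z w : SiteY (f j).toKIdx), parA j U z w = (parA j U w z)⁻¹)
    (hunitA : ∀ j (α₀ : ℝ) (U : CfgY 𝔸 (f j).toKIdx), MInv ≤ (geo9Y (f j)).M → 0 < α₀ → (geo9Y (f j)).M * α₀ ≤ aInv →
      (bg9YC 𝔸 G P (f j)).Reg335 c35 α₀ U →
      IsUnit (deltaAY (f j).toKIdx (parA j) (parBY (f j).toKIdx) (GpY (f j).toKIdx (parA j)) U)) (hb₁ : 0 ≤ b₁)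
    (C₀ : ℝ) (hC₀ : 0 ≤ C₀)
    (hreg335P : ∀ j (α₀ : ℝ) (U : CfgY 𝔸 (f j).toKIdx), MInv ≤ (geo9Y (f j)).M → 0 < α₀ → (geo9Y (f j)).M * α₀ ≤ aInv →
      (bg9YC 𝔸 G P (f j)).Reg335 c35 α₀ U → Reg335PlaqY G (f j) (ιB j) C₀ U)
    (hC37G : ∀ j β' U a, C37 j β' U a → CplxLettersGY G (f j) (ιB j) β' U a)
    (cVar : ℝ) (hcVar : 0 ≤ cVar) (hvarB : ∀ j β' U a, C37 j β' U a → VarParBY (f j).toKIdx (parBY (f j).toKIdx) cVar β' U a)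
    (hMd : 2 * ((d : ℝ) + 1) < MInv) (mN : ℕ) (hnbr : ∀ (j : J) (y' : IBondY (f j).toKIdx), (nbr (geo9Y (f j)) (2 * ((d : ℝ) + 1)) y').card ≤ mN)
    (hMr : rLB d ℓ + 1 < MInv) (d261 : ℝ → ℕ)
    (h261 : ∀ (j : J) (δ α : ℝ), 0 < δ → δ ≤ 1 → 9 / 5000 ≤ α → α < 1 →
      (gFrame₅CodedOnSel P f c35 G parA (fun j => parBY (f j).toKIdx) b ιB C37 C38 hι hG1 M₂ hM₂ hrepr hcR Cq hCq hC37 MInv aInv aW hMInv haInv haW hparG hparC hunitG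
        hunitXG hsym hunitA (hparB_parBY f G) hb₁ C₀ hC₀ hreg335P hC37G cVar hcVar hvarB hMd mN hnbr).M261 δ ≤ (geo9Y (f j)).M →
      Ineq261 (d261 δ) (toB6 (geo9Y (f j)) 0 True) δ α) :
    StepH1Pos (d + 1) c35 (fun j => geo9Y (f j)) (fun j => (codingYx P G (f j) (C37 j) (C38 j)).bg) (fun j => KSC₇Par P G (f j) (parA j) (parH j) (C37 j) (C38 j))
      (fun j => KACU P G (f j) (GAY (f j).toKIdx (parA j) (parBY (f j).toKIdx) (GpY (f j).toKIdx (parA j))) (parBY (f j).toKIdx) (C37 j) (C38 j))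
      (fun j => pullS (codingYx P G (f j) (C37 j) (C38 j)) (CinvY P f G parA j))
      (fun j => KACU P G (f j) (GAY (f j).toKIdx (parA j) (parBY (f j).toKIdx) (GpY (f j).toKIdx (parA j))) (parBY (f j).toKIdx) (C37 j) (C38 j)) :=
  stepH1Pos_of_h1GFrame₆ (F := (h1GFrame₆CodedOnSel P f c35 G parA (fun j => parBY (f j).toKIdx) b ιB C37 C38 hι hG1 M₂ hM₂ hrepr hcR Cq hCq hC37 MInv aInv aW hMInv haInv haW hparG hparC hunitG hunitXG hsym hunitA
        (hparB_parBY f G) hb₁ C₀ hC₀ hreg335P hC37G cVar hcVar hvarB hMd mN hnbr (by positivity : (0 : ℝ) ≤ (d : ℝ) + 1)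
        (rLB_nonneg d ℓ) (hLipB_parBY P f c35 G hG1) hMr).swapGp (fun j => KSC₇Par P G (f j) (parA j) (parH j) (C37 j) (C38 j))
      (fun j _ _ c => eBlock_KSC₇Par_iff P G (f j) (parA j) (parH j) (C37 j) (C38 j) c)) d261 h261

/-- ★ **THE (3.44) MEMBER OF `KACU` THROUGH THE RE-KEYED G FRAME**: `stepE4Pos_of_e4h2GFrame₆` on `B9SectBE4H2GFrameCodedYRG.e4h2GFrame₆CodedOn` AT `parA` re-keyed by
`E4H2GFrame₆.swapGp`. [cite: Balaban1985BackgroundPropagators, Thm 3.4 p.400, Thm 3.3 p.399, (3.44) p.398, (3.82)–(3.86) p.407; Balaban1984PropagatorsII, Lemma 2.1 p.234] -/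
theorem stepE4Pos_KACU_frameParG_on (hι : ∀ (j : J) (s : BlkY (f j).toKIdx), β (f j).toKIdx.hN (f j).toKIdx.D (f j).toKIdx.hk (ιB j s) = s)
    (hG1 : ∀ u : 𝔸ˣ, u ∈ G → ‖(u : 𝔸)‖ ≤ 1)
    (M₂ : ℝ) (hM₂ : 0 ≤ M₂) (hrepr : ∀ (v : 𝔸) (j : ι), |b.repr v j| ≤ M₂ * ‖v‖) (hcR : 0 < M₂ * ∑ j, ‖b j‖)
    (Cq : ℝ) (hCq : 0 ≤ Cq) (hC37 : ∀ j β' U a, C37 j β' U a → GVal G (f j).toKIdx U ∧ CplxLettersY G (f j) (parA j) (ιB j) Cq β' U a)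
    (MInv aInv aW : ℝ) (hMInv : 0 < MInv) (haInv : 0 < aInv) (haW : 0 < aW)
    (hparG : ∀ j (α₀ : ℝ) (U : CfgY 𝔸 (f j).toKIdx), MInv ≤ (geo9Y (f j)).M → 0 < α₀ → (geo9Y (f j)).M * α₀ ≤ aInv →
      (bg9YC 𝔸 G P (f j)).Reg335 c35 α₀ U → ∀ z w, parA j U z w ∈ G)
    (hparC : ∀ j β' U a, C37 j β' U a → ∀ z w, parA j U z w ∈ G)
    (hunitG : ∀ j (α₀ : ℝ) (U : CfgY 𝔸 (f j).toKIdx), MInv ≤ (geo9Y (f j)).M → 0 < α₀ → (geo9Y (f j)).M * α₀ ≤ aInv →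
      (bg9YC 𝔸 G P (f j)).Reg335 c35 α₀ U → IsUnit (deltaPrimeAY (f j).toKIdx (parA j) U))
    (hunitXG : ∀ j (α₀ : ℝ) (U : CfgY 𝔸 (f j).toKIdx), MInv ≤ (geo9Y (f j)).M → 0 < α₀ → (geo9Y (f j)).M * α₀ ≤ aInv →
      (bg9YC 𝔸 G P (f j)).Reg335 c35 α₀ U → IsUnit (XY (f j).toKIdx (parA j) (GpY (f j).toKIdx (parA j)) U))
    (hsym : ∀ j (U : CfgY 𝔸 (f j).toKIdx) (z w : SiteY (f j).toKIdx), parA j U z w = (parA j U w z)⁻¹)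
    (hunitA : ∀ j (α₀ : ℝ) (U : CfgY 𝔸 (f j).toKIdx), MInv ≤ (geo9Y (f j)).M → 0 < α₀ → (geo9Y (f j)).M * α₀ ≤ aInv →
      (bg9YC 𝔸 G P (f j)).Reg335 c35 α₀ U →
      IsUnit (deltaAY (f j).toKIdx (parA j) (parBY (f j).toKIdx) (GpY (f j).toKIdx (parA j)) U)) (hb₁ : 0 ≤ b₁)
    (C₀ : ℝ) (hC₀ : 0 ≤ C₀)
    (hreg335P : ∀ j (α₀ : ℝ) (U : CfgY 𝔸 (f j).toKIdx), MInv ≤ (geo9Y (f j)).M → 0 < α₀ → (geo9Y (f j)).M * α₀ ≤ aInv →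
      (bg9YC 𝔸 G P (f j)).Reg335 c35 α₀ U → Reg335PlaqY G (f j) (ιB j) C₀ U)
    (hC37G : ∀ j β' U a, C37 j β' U a → CplxLettersGY G (f j) (ιB j) β' U a)
    (cVar : ℝ) (hcVar : 0 ≤ cVar) (hvarB : ∀ j β' U a, C37 j β' U a → VarParBY (f j).toKIdx (parBY (f j).toKIdx) cVar β' U a)
    (hMd : 2 * ((d : ℝ) + 1) < MInv) (mN : ℕ) (hnbr : ∀ (j : J) (y' : IBondY (f j).toKIdx), (nbr (geo9Y (f j)) (2 * ((d : ℝ) + 1)) y').card ≤ mN)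
    (d261 : ℝ → ℕ)
    (h261 : ∀ (j : J) (δ α : ℝ), 0 < δ → δ ≤ 1 → 9 / 5000 ≤ α → α < 1 →
      (gFrame₅CodedOnSel P f c35 G parA (fun j => parBY (f j).toKIdx) b ιB C37 C38 hι hG1 M₂ hM₂ hrepr hcR Cq hCq hC37 MInv aInv aW hMInv haInv haW hparG hparC hunitG
        hunitXG hsym hunitA (hparB_parBY f G) hb₁ C₀ hC₀ hreg335P hC37G cVar hcVar hvarB hMd mN hnbr).M261 δ ≤ (geo9Y (f j)).M →
      Ineq261 (d261 δ) (toB6 (geo9Y (f j)) 0 True) δ α) :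
    StepE4Pos (d + 1) c35 (fun j => geo9Y (f j)) (fun j => (codingYx P G (f j) (C37 j) (C38 j)).bg) (fun j => KSC₇Par P G (f j) (parA j) (parH j) (C37 j) (C38 j))
      (fun j => KACU P G (f j) (GAY (f j).toKIdx (parA j) (parBY (f j).toKIdx) (GpY (f j).toKIdx (parA j))) (parBY (f j).toKIdx) (C37 j) (C38 j))
      (fun j => pullS (codingYx P G (f j) (C37 j) (C38 j)) (CinvY P f G parA j))
      (fun j => KACU P G (f j) (GAY (f j).toKIdx (parA j) (parBY (f j).toKIdx) (GpY (f j).toKIdx (parA j))) (parBY (f j).toKIdx) (C37 j) (C38 j)) :=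
  stepE4Pos_of_e4h2GFrame₆ (F := (e4h2GFrame₆CodedOnSel P f c35 G parA (fun j => parBY (f j).toKIdx) b ιB C37 C38 hι hG1 M₂ hM₂ hrepr hcR Cq hCq hC37 MInv aInv aW hMInv haInv haW hparG hparC hunitG hunitXG hsym hunitA
        (hparB_parBY f G) hb₁ C₀ hC₀ hreg335P hC37G cVar hcVar hvarB hMd mN hnbr).swapGp (fun j => KSC₇Par P G (f j) (parA j) (parH j) (C37 j) (C38 j))
      (fun j _ _ c => eBlock_KSC₇Par_iff P G (f j) (parA j) (parH j) (C37 j) (C38 j) c)) d261 h261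

/-- ★ **THE (3.45) MEMBER OF `KACU` THROUGH THE RE-KEYED G FRAME**: `stepH2Pos_of_e4h2GFrame₆` on the same re-keyed frame.
[cite: Balaban1985BackgroundPropagators, Thm 3.4 p.400, Thm 3.3 p.399, (3.45) p.398, (3.82)–(3.86) p.407; Balaban1984PropagatorsII, Lemma 2.1 p.234] -/
theorem stepH2Pos_KACU_frameParG_on (hι : ∀ (j : J) (s : BlkY (f j).toKIdx), β (f j).toKIdx.hN (f j).toKIdx.D (f j).toKIdx.hk (ιB j s) = s)
    (hG1 : ∀ u : 𝔸ˣ, u ∈ G → ‖(u : 𝔸)‖ ≤ 1)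
    (M₂ : ℝ) (hM₂ : 0 ≤ M₂) (hrepr : ∀ (v : 𝔸) (j : ι), |b.repr v j| ≤ M₂ * ‖v‖) (hcR : 0 < M₂ * ∑ j, ‖b j‖)
    (Cq : ℝ) (hCq : 0 ≤ Cq) (hC37 : ∀ j β' U a, C37 j β' U a → GVal G (f j).toKIdx U ∧ CplxLettersY G (f j) (parA j) (ιB j) Cq β' U a)
    (MInv aInv aW : ℝ) (hMInv : 0 < MInv) (haInv : 0 < aInv) (haW : 0 < aW)
    (hparG : ∀ j (α₀ : ℝ) (U : CfgY 𝔸 (f j).toKIdx), MInv ≤ (geo9Y (f j)).M → 0 < α₀ → (geo9Y (f j)).M * α₀ ≤ aInv →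
      (bg9YC 𝔸 G P (f j)).Reg335 c35 α₀ U → ∀ z w, parA j U z w ∈ G)
    (hparC : ∀ j β' U a, C37 j β' U a → ∀ z w, parA j U z w ∈ G)
    (hunitG : ∀ j (α₀ : ℝ) (U : CfgY 𝔸 (f j).toKIdx), MInv ≤ (geo9Y (f j)).M → 0 < α₀ → (geo9Y (f j)).M * α₀ ≤ aInv →
      (bg9YC 𝔸 G P (f j)).Reg335 c35 α₀ U → IsUnit (deltaPrimeAY (f j).toKIdx (parA j) U))
    (hunitXG : ∀ j (α₀ : ℝ) (U : CfgY 𝔸 (f j).toKIdx), MInv ≤ (geo9Y (f j)).M → 0 < α₀ → (geo9Y (f j)).M * α₀ ≤ aInv →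
      (bg9YC 𝔸 G P (f j)).Reg335 c35 α₀ U → IsUnit (XY (f j).toKIdx (parA j) (GpY (f j).toKIdx (parA j)) U))
    (hsym : ∀ j (U : CfgY 𝔸 (f j).toKIdx) (z w : SiteY (f j).toKIdx), parA j U z w = (parA j U w z)⁻¹)
    (hunitA : ∀ j (α₀ : ℝ) (U : CfgY 𝔸 (f j).toKIdx), MInv ≤ (geo9Y (f j)).M → 0 < α₀ → (geo9Y (f j)).M * α₀ ≤ aInv →
      (bg9YC 𝔸 G P (f j)).Reg335 c35 α₀ U →
      IsUnit (deltaAY (f j).toKIdx (parA j) (parBY (f j).toKIdx) (GpY (f j).toKIdx (parA j)) U)) (hb₁ : 0 ≤ b₁)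
    (C₀ : ℝ) (hC₀ : 0 ≤ C₀)
    (hreg335P : ∀ j (α₀ : ℝ) (U : CfgY 𝔸 (f j).toKIdx), MInv ≤ (geo9Y (f j)).M → 0 < α₀ → (geo9Y (f j)).M * α₀ ≤ aInv →
      (bg9YC 𝔸 G P (f j)).Reg335 c35 α₀ U → Reg335PlaqY G (f j) (ιB j) C₀ U)
    (hC37G : ∀ j β' U a, C37 j β' U a → CplxLettersGY G (f j) (ιB j) β' U a)
    (cVar : ℝ) (hcVar : 0 ≤ cVar) (hvarB : ∀ j β' U a, C37 j β' U a → VarParBY (f j).toKIdx (parBY (f j).toKIdx) cVar β' U a)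
    (hMd : 2 * ((d : ℝ) + 1) < MInv) (mN : ℕ) (hnbr : ∀ (j : J) (y' : IBondY (f j).toKIdx), (nbr (geo9Y (f j)) (2 * ((d : ℝ) + 1)) y').card ≤ mN)
    (d261 : ℝ → ℕ)
    (h261 : ∀ (j : J) (δ α : ℝ), 0 < δ → δ ≤ 1 → 9 / 5000 ≤ α → α < 1 →
      (gFrame₅CodedOnSel P f c35 G parA (fun j => parBY (f j).toKIdx) b ιB C37 C38 hι hG1 M₂ hM₂ hrepr hcR Cq hCq hC37 MInv aInv aW hMInv haInv haW hparG hparC hunitG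
        hunitXG hsym hunitA (hparB_parBY f G) hb₁ C₀ hC₀ hreg335P hC37G cVar hcVar hvarB hMd mN hnbr).M261 δ ≤ (geo9Y (f j)).M →
      Ineq261 (d261 δ) (toB6 (geo9Y (f j)) 0 True) δ α) :
    StepH2Pos (d + 1) c35 (fun j => geo9Y (f j)) (fun j => (codingYx P G (f j) (C37 j) (C38 j)).bg) (fun j => KSC₇Par P G (f j) (parA j) (parH j) (C37 j) (C38 j))
      (fun j => KACU P G (f j) (GAY (f j).toKIdx (parA j) (parBY (f j).toKIdx) (GpY (f j).toKIdx (parA j))) (parBY (f j).toKIdx) (C37 j) (C38 j))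
      (fun j => pullS (codingYx P G (f j) (C37 j) (C38 j)) (CinvY P f G parA j))
      (fun j => KACU P G (f j) (GAY (f j).toKIdx (parA j) (parBY (f j).toKIdx) (GpY (f j).toKIdx (parA j))) (parBY (f j).toKIdx) (C37 j) (C38 j)) :=
  stepH2Pos_of_e4h2GFrame₆ (F := (e4h2GFrame₆CodedOnSel P f c35 G parA (fun j => parBY (f j).toKIdx) b ιB C37 C38 hι hG1 M₂ hM₂ hrepr hcR Cq hCq hC37 MInv aInv aW hMInv haInv haW hparG hparC hunitG hunitXG hsym hunitA
        (hparB_parBY f G) hb₁ C₀ hC₀ hreg335P hC37G cVar hcVar hvarB hMd mN hnbr).swapGp (fun j => KSC₇Par P G (f j) (parA j) (parH j) (C37 j) (C38 j))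
      (fun j _ _ c => eBlock_KSC₇Par_iff P G (f j) (parA j) (parH j) (C37 j) (C38 j) c)) d261 h261

/-- ★ **THE (3.46) MEMBER OF `KACU` THROUGH THE RE-KEYED G FRAME** ((3.77) in block-`ℓ²` PROVED at `parA` by `read377L2_gFrame₅CodedOn`): `stepL2Pos_of_l2GFrame₈` on
`B9SectBL2GFrameCodedV8YRG.l2GFrame₈CodedOn … (read377L2_gFrame₅CodedOn …)` AT `parA`, re-keyed by `L2GFrame₈.swapGp` (the displayed (3.77) field reads the (3.42) and
(3.46) blocks of the G′ family — both transporter-blind). [cite: Balaban1985BackgroundPropagators, Thm 3.4 p.400, Thm 3.3 p.399, (3.46) p.398, (3.77) p.406, (3.82)–(3.86) p.407; Balaban1984PropagatorsII, Prop. 2.6 (2.140)–(2.141) p.247, Lemma 2.1 p.234] -/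
theorem stepL2Pos_KACU_frameParG_on (hι : ∀ (j : J) (s : BlkY (f j).toKIdx), β (f j).toKIdx.hN (f j).toKIdx.D (f j).toKIdx.hk (ιB j s) = s)
    (hG1 : ∀ u : 𝔸ˣ, u ∈ G → ‖(u : 𝔸)‖ ≤ 1)
    (M₂ : ℝ) (hM₂ : 0 ≤ M₂) (hrepr : ∀ (v : 𝔸) (j : ι), |b.repr v j| ≤ M₂ * ‖v‖) (hcR : 0 < M₂ * ∑ j, ‖b j‖)
    (Cq : ℝ) (hCq : 0 ≤ Cq) (hC37 : ∀ j β' U a, C37 j β' U a → GVal G (f j).toKIdx U ∧ CplxLettersY G (f j) (parA j) (ιB j) Cq β' U a)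
    (MInv aInv aW : ℝ) (hMInv : 0 < MInv) (haInv : 0 < aInv) (haW : 0 < aW)
    (hparG : ∀ j (α₀ : ℝ) (U : CfgY 𝔸 (f j).toKIdx), MInv ≤ (geo9Y (f j)).M → 0 < α₀ → (geo9Y (f j)).M * α₀ ≤ aInv →
      (bg9YC 𝔸 G P (f j)).Reg335 c35 α₀ U → ∀ z w, parA j U z w ∈ G)
    (hparC : ∀ j β' U a, C37 j β' U a → ∀ z w, parA j U z w ∈ G)
    (hunitG : ∀ j (α₀ : ℝ) (U : CfgY 𝔸 (f j).toKIdx), MInv ≤ (geo9Y (f j)).M → 0 < α₀ → (geo9Y (f j)).M * α₀ ≤ aInv →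
      (bg9YC 𝔸 G P (f j)).Reg335 c35 α₀ U → IsUnit (deltaPrimeAY (f j).toKIdx (parA j) U))
    (hunitXG : ∀ j (α₀ : ℝ) (U : CfgY 𝔸 (f j).toKIdx), MInv ≤ (geo9Y (f j)).M → 0 < α₀ → (geo9Y (f j)).M * α₀ ≤ aInv →
      (bg9YC 𝔸 G P (f j)).Reg335 c35 α₀ U → IsUnit (XY (f j).toKIdx (parA j) (GpY (f j).toKIdx (parA j)) U))
    (hsym : ∀ j (U : CfgY 𝔸 (f j).toKIdx) (z w : SiteY (f j).toKIdx), parA j U z w = (parA j U w z)⁻¹)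
    (hunitA : ∀ j (α₀ : ℝ) (U : CfgY 𝔸 (f j).toKIdx), MInv ≤ (geo9Y (f j)).M → 0 < α₀ → (geo9Y (f j)).M * α₀ ≤ aInv →
      (bg9YC 𝔸 G P (f j)).Reg335 c35 α₀ U →
      IsUnit (deltaAY (f j).toKIdx (parA j) (parBY (f j).toKIdx) (GpY (f j).toKIdx (parA j)) U)) (hb₁ : 0 ≤ b₁)
    (C₀ : ℝ) (hC₀ : 0 ≤ C₀)
    (hreg335P : ∀ j (α₀ : ℝ) (U : CfgY 𝔸 (f j).toKIdx), MInv ≤ (geo9Y (f j)).M → 0 < α₀ → (geo9Y (f j)).M * α₀ ≤ aInv →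
      (bg9YC 𝔸 G P (f j)).Reg335 c35 α₀ U → Reg335PlaqY G (f j) (ιB j) C₀ U)
    (hC37G : ∀ j β' U a, C37 j β' U a → CplxLettersGY G (f j) (ιB j) β' U a)
    (cVar : ℝ) (hcVar : 0 ≤ cVar) (hvarB : ∀ j β' U a, C37 j β' U a → VarParBY (f j).toKIdx (parBY (f j).toKIdx) cVar β' U a)
    (hMd : 2 * ((d : ℝ) + 1) < MInv) (mN : ℕ) (hnbr : ∀ (j : J) (y' : IBondY (f j).toKIdx), (nbr (geo9Y (f j)) (2 * ((d : ℝ) + 1)) y').card ≤ mN)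
    (d261 : ℝ → ℕ)
    (h261 : ∀ (j : J) (δ α : ℝ), 0 < δ → δ ≤ 1 → 9 / 5000 ≤ α → α < 1 →
      (gFrame₅CodedOnSel P f c35 G parA (fun j => parBY (f j).toKIdx) b ιB C37 C38 hι hG1 M₂ hM₂ hrepr hcR Cq hCq hC37 MInv aInv aW hMInv haInv haW hparG hparC hunitG
        hunitXG hsym hunitA (hparB_parBY f G) hb₁ C₀ hC₀ hreg335P hC37G cVar hcVar hvarB hMd mN hnbr).M261 δ ≤ (geo9Y (f j)).M →
      Ineq261 (d261 δ) (toB6 (geo9Y (f j)) 0 True) δ α) :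
    StepL2Pos (d + 1) c35 (fun j => geo9Y (f j)) (fun j => (codingYx P G (f j) (C37 j) (C38 j)).bg) (fun j => KSC₇Par P G (f j) (parA j) (parH j) (C37 j) (C38 j))
      (fun j => KACU P G (f j) (GAY (f j).toKIdx (parA j) (parBY (f j).toKIdx) (GpY (f j).toKIdx (parA j))) (parBY (f j).toKIdx) (C37 j) (C38 j))
      (fun j => pullS (codingYx P G (f j) (C37 j) (C38 j)) (CinvY P f G parA j))
      (fun j => KACU P G (f j) (GAY (f j).toKIdx (parA j) (parBY (f j).toKIdx) (GpY (f j).toKIdx (parA j))) (parBY (f j).toKIdx) (C37 j) (C38 j)) :=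
  stepL2Pos_of_l2GFrame₈ (F := (l2GFrame₈CodedOnSel P f c35 G parA (fun j => parBY (f j).toKIdx) b ιB C37 C38 hι hG1 M₂ hM₂ hrepr hcR Cq hCq hC37 MInv aInv aW hMInv haInv haW hparG hparC hunitG hunitXG hsym hunitA
        (hparB_parBY f G) hb₁ C₀ hC₀ hreg335P hC37G cVar hcVar hvarB hMd mN hnbr
        (read377L2_gFrame₅CodedOnSel P f c35 G parA (fun j => parBY (f j).toKIdx) b ιB C37 C38 hι hG1 M₂ hM₂ hrepr hcR Cq hCq hC37 MInv aInv aW hMInv haInv haW hparG hparC hunitG hunitXG hsym hunitA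
        (hparB_parBY f G) hb₁ C₀ hC₀ hreg335P hC37G cVar hcVar hvarB hMd mN hnbr)).swapGp (fun j => KSC₇Par P G (f j) (parA j) (parH j) (C37 j) (C38 j))
      (fun j _ _ c => eBlock_KSC₇Par_iff P G (f j) (parA j) (parH j) (C37 j) (C38 j) c)
      (fun j _ _ c => l2Block_KSC₇Par_iff P G (f j) (parA j) (parH j) (C37 j) (C38 j) c)) d261 h261

end GSide

/-! ## §2 ★★★ `SectBStepUPar` assembled from the sixteen members -/

section Assembly

/-- ★★★ **THE ROW-13 STEP OF RECORD WITH THE TWO TRANSPORTER ROLES SEPARATED — `SectBStepUPar P f (d+1) c35 G b parA parH (GAY … parA parBY (GpY parA)) parBY C37 C38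
(CinvY P f G parA)` PROVED on a subfamily `f` with sections `ιB`**: print's Sect. B step («Thus Theorem 3.4 is proved, assuming that Theorems 3.1–3.3 hold», p.407) in
U-letters over dag-n06-c's coded carrier, for the two-transporter site-sector reading `KSCUPar parA parH` (averaging contours (3.21) in `G′ = GpY parA`, Hölder contours
(3.40) in the (3.43)∕(3.45) quotients transported by `parH`), the bond reading `KACU (GAY parA parBY (GpY parA)) parBY`, the (3.48) kernel `CinvY … parA` and the
analyticity pin `IsAnKY parA`; ASSEMBLED by `B9SectBStepWhole.sectBStepPrinted_of_posBlockSteps` from the eight G′ members of this road (`stepEPos ∕ stepGlobPos ∕ stepE4Pos ∕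
stepKerPos ∕ stepAnalyticPos_KSCUParG_on`, `stepL2Pos_KSCUParG_on`, `stepH1Pos_KSCUParG_on`, `stepH2Pos_KSCUParG_on`) and §1's six G members.  DISPLAYED — structural:
`hι hG1 b M₂ hrepr hcR hcL MInv aInv aW hMd hMr mN hnbr hb₁ C₀ hreg335P hC37 hC37G cVar hvarB cP hplaq (d261, h261)` (as `B9SectBStepUGuardedR.sectBStepU_of_members_g`,
all GUARDED where the record guards them); the AVERAGING-transporter laws AT `parA`: `hparG ∕ hparC` (values in `G`), `hunitG` (`Δ′_a(U)` a unit), `hunitXG` (`(Q′G′²Q′*)(U)` a unit),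
`hsym` (reversal), `hunitA` (`Δ_a(U)` a unit on the class, GUARDED — Thm 3.1∕3.11's regime); the HÖLDER-transporter laws AT `parH`: `hparH` (values in `G`), `hLip`
(`Reg335 ⇒ HolderLipY c_Lip (parH U) U`); the record's Theorem 3.2 `h32` for `C = CY parA (GpY parA)`; Theorem 3.3 `h33` READ OVER THE CODED CARRIERS for `(KSCUPar parA
parH, KACU)` (from the record-level Theorem 3.3 for `(kernelFamilyS … (GpY parA) parH, kernelFamilyB … OA parBY)` by dag-n06-d's `B9LeafXCodedKnitUParH.thm33Printed_codedUPar`).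
[cite: Balaban1985BackgroundPropagators, Thm 3.4 p.400, Sect. B (3.50)–(3.86) pp.400–407, p.403 l.1–9, p.407, Thms 3.1–3.3 (3.42)–(3.48) pp.397–399, (3.21) p.394, (3.40) p.397, (3.35)–(3.37) p.396, (3.77) p.406; Balaban1984PropagatorsII, Lemma 2.1 p.234, (2.45) p.231, (2.51) p.232] -/
theorem sectBStepUParG_of_members (hι : ∀ (j : J) (s : BlkY (f j).toKIdx), β (f j).toKIdx.hN (f j).toKIdx.D (f j).toKIdx.hk (ιB j s) = s)
    (hG1 : ∀ u : 𝔸ˣ, u ∈ G → ‖(u : 𝔸)‖ ≤ 1)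
    (hparH : ∀ j (U : CfgY 𝔸 (f j).toKIdx), GVal G (f j).toKIdx U → ∀ z w, parH j U z w ∈ G)
    (M₂ : ℝ) (hM₂ : 0 ≤ M₂) (hrepr : ∀ (v : 𝔸) (j : ι), |b.repr v j| ≤ M₂ * ‖v‖) (hcR : 0 < M₂ * ∑ j, ‖b j‖)
    (hcL : 0 < Real.sqrt (Fintype.card ι) * M₂ * ∑ j, ‖b j‖)
    (Cq : ℝ) (hCq : 0 ≤ Cq)
    (hC37 : ∀ j β' U a, C37 j β' U a → GVal G (f j).toKIdx U ∧ CplxLettersY G (f j) (parA j) (ιB j) Cq β' U a)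
    (MInv aInv aW : ℝ) (hMInv : 0 < MInv) (haInv : 0 < aInv) (haW : 0 < aW)
    (hparG : ∀ j (α₀ : ℝ) (U : CfgY 𝔸 (f j).toKIdx), MInv ≤ (geo9Y (f j)).M → 0 < α₀ → (geo9Y (f j)).M * α₀ ≤ aInv →
      (bg9YC 𝔸 G P (f j)).Reg335 c35 α₀ U → ∀ z w, parA j U z w ∈ G)
    (hparC : ∀ j β' U a, C37 j β' U a → ∀ z w, parA j U z w ∈ G)
    (hunitG : ∀ j (α₀ : ℝ) (U : CfgY 𝔸 (f j).toKIdx), MInv ≤ (geo9Y (f j)).M → 0 < α₀ → (geo9Y (f j)).M * α₀ ≤ aInv →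
      (bg9YC 𝔸 G P (f j)).Reg335 c35 α₀ U → IsUnit (deltaPrimeAY (f j).toKIdx (parA j) U))
    (hunitXG : ∀ j (α₀ : ℝ) (U : CfgY 𝔸 (f j).toKIdx), MInv ≤ (geo9Y (f j)).M → 0 < α₀ → (geo9Y (f j)).M * α₀ ≤ aInv →
      (bg9YC 𝔸 G P (f j)).Reg335 c35 α₀ U → IsUnit (XY (f j).toKIdx (parA j) (GpY (f j).toKIdx (parA j)) U))
    (hsym : ∀ j (U : CfgY 𝔸 (f j).toKIdx) (z w : SiteY (f j).toKIdx), parA j U z w = (parA j U w z)⁻¹)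
    (hunitA : ∀ j (α₀ : ℝ) (U : CfgY 𝔸 (f j).toKIdx), MInv ≤ (geo9Y (f j)).M → 0 < α₀ → (geo9Y (f j)).M * α₀ ≤ aInv →
      (bg9YC 𝔸 G P (f j)).Reg335 c35 α₀ U → IsUnit (deltaAY (f j).toKIdx (parA j) (parBY (f j).toKIdx) (GpY (f j).toKIdx (parA j)) U)) (hb₁ : 0 ≤ b₁)
    (C₀ : ℝ) (hC₀ : 0 ≤ C₀)
    (hreg335P : ∀ j (α₀ : ℝ) (U : CfgY 𝔸 (f j).toKIdx), MInv ≤ (geo9Y (f j)).M → 0 < α₀ → (geo9Y (f j)).M * α₀ ≤ aInv →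
      (bg9YC 𝔸 G P (f j)).Reg335 c35 α₀ U → Reg335PlaqY G (f j) (ιB j) C₀ U)
    (hC37G : ∀ j β' U a, C37 j β' U a → CplxLettersGY G (f j) (ιB j) β' U a)
    (cVar : ℝ) (hcVar : 0 ≤ cVar) (hvarB : ∀ j β' U a, C37 j β' U a → VarParBY (f j).toKIdx (parBY (f j).toKIdx) cVar β' U a)
    (hMd : 2 * ((d : ℝ) + 1) < MInv) (mN : ℕ) (hnbr : ∀ (j : J) (y' : IBondY (f j).toKIdx), (nbr (geo9Y (f j)) (2 * ((d : ℝ) + 1)) y').card ≤ mN)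
    (hMr : rLB d ℓ + 1 < MInv)
    {cLip : ℝ} (hcLip : 0 ≤ cLip)
    (hLip : ∀ (j : J) (α₀ : ℝ) (U : CfgY 𝔸 (f j).toKIdx), (bg9YC 𝔸 G P (f j)).Reg335 c35 α₀ U → HolderLipY (f j).toKIdx cLip (parH j U) U)
    {cP : ℝ} (hcP : 0 ≤ cP)
    (hplaq : ∀ (j : J) (α₀ : ℝ) (U : CfgY 𝔸 (f j).toKIdx), MInv ≤ (geo9Y (f j)).M → 0 < α₀ → (geo9Y (f j)).M * α₀ ≤ aInv →
      (bg9YC 𝔸 G P (f j)).Reg335 c35 α₀ U → PlaqLawY (f j) (ιB j) cP U)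
    (d261 : ℝ → ℕ)
    (h261 : ∀ (j : J) (δ α : ℝ), 0 < δ → δ ≤ 1 → 9 / 5000 ≤ α → α < 1 →
      (gFrame₅CodedOnSel P f c35 G parA (fun j => parBY (f j).toKIdx) b ιB C37 C38 hι hG1 M₂ hM₂ hrepr hcR Cq hCq hC37 MInv aInv aW hMInv haInv haW hparG hparC hunitG
        hunitXG hsym hunitA (hparB_parBY f G) hb₁ C₀ hC₀ hreg335P hC37G cVar hcVar hvarB hMd mN hnbr).M261 δ ≤ (geo9Y (f j)).M →
      Ineq261 (d261 δ) (toB6 (geo9Y (f j)) 0 True) δ α)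
    (h32 : B9.Thm32Printed (d + 1) c35 (fun j => geo9Y (f j)) (fun j => bg9YC 𝔸 G P (f j)) (CinvY P f G parA))
    (h33 : B9.Thm33Printed c35 (fun j => geo9Y (f j)) (fun j => (codingYx P G (f j) (C37 j) (C38 j)).bg)
      (fun j => KSCUPar P G (f j) (parA j) (parH j) (C37 j) (C38 j))
      (fun j => KACU P G (f j) (GAY (f j).toKIdx (parA j) (parBY (f j).toKIdx) (GpY (f j).toKIdx (parA j))) (parBY (f j).toKIdx) (C37 j) (C38 j))) :
    SectBStepUPar P f (d + 1) c35 G b parA parH (fun j => GAY (f j).toKIdx (parA j) (parBY (f j).toKIdx) (GpY (f j).toKIdx (parA j))) (fun j => parBY (f j).toKIdx)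
      C37 C38 (CinvY P f G parA) := by
  -- the G side: §1's six re-keyed frame steps (G′-input `KSC₇Par`), moved to the `KSCUPar` input slot
  have hEa := stepPos_KSCUPar_of_KSC₇Par P f c35 G b ιB C38 parA parH C37 (fun j => GAY (f j).toKIdx (parA j) (parBY (f j).toKIdx) (GpY (f j).toKIdx (parA j))) (fun j => parBY (f j).toKIdx)
    (CinvY P f G parA) hι hG1 hM₂ hrepr (d + 1)
    (stepEPos_KACU_frameParG_on P f c35 G b ιB C38 parA parH C37 hι hG1 M₂ hM₂ hrepr hcR Cq hCq hC37 MInv aInv aW hMInv haInv haW hparG hparC hunitG hunitXG hsym hunitA hb₁ C₀ hC₀ hreg335P hC37G cVar hcVar hvarB hMd mN hnbr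
      d261 h261)
  have hGa := stepPos_KSCUPar_of_KSC₇Par P f c35 G b ιB C38 parA parH C37 (fun j => GAY (f j).toKIdx (parA j) (parBY (f j).toKIdx) (GpY (f j).toKIdx (parA j))) (fun j => parBY (f j).toKIdx)
    (CinvY P f G parA) hι hG1 hM₂ hrepr (d + 1)
    (stepGlobPos_KACU_frameParG_on P f c35 G b ιB C38 parA parH C37 hι hG1 M₂ hM₂ hrepr hcR Cq hCq hC37 MInv aInv aW hMInv haInv haW hparG hparC hunitG hunitXG hsym hunitA hb₁ C₀ hC₀ hreg335P hC37G cVar hcVar hvarB hMd mN hnbr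
      d261 h261)
  have hH1a := stepPos_KSCUPar_of_KSC₇Par P f c35 G b ιB C38 parA parH C37 (fun j => GAY (f j).toKIdx (parA j) (parBY (f j).toKIdx) (GpY (f j).toKIdx (parA j))) (fun j => parBY (f j).toKIdx)
    (CinvY P f G parA) hι hG1 hM₂ hrepr (d + 1)
    (stepH1Pos_KACU_frameParG_on P f c35 G b ιB C38 parA parH C37 hι hG1 M₂ hM₂ hrepr hcR Cq hCq hC37 MInv aInv aW hMInv haInv haW hparG hparC hunitG hunitXG hsym hunitA hb₁ C₀ hC₀ hreg335P hC37G cVar hcVar hvarB hMd mN hnbr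
      hMr d261 h261)
  have hE4a := stepPos_KSCUPar_of_KSC₇Par P f c35 G b ιB C38 parA parH C37 (fun j => GAY (f j).toKIdx (parA j) (parBY (f j).toKIdx) (GpY (f j).toKIdx (parA j))) (fun j => parBY (f j).toKIdx)
    (CinvY P f G parA) hι hG1 hM₂ hrepr (d + 1)
    (stepE4Pos_KACU_frameParG_on P f c35 G b ιB C38 parA parH C37 hι hG1 M₂ hM₂ hrepr hcR Cq hCq hC37 MInv aInv aW hMInv haInv haW hparG hparC hunitG hunitXG hsym hunitA hb₁ C₀ hC₀ hreg335P hC37G cVar hcVar hvarB hMd mN hnbr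
      d261 h261)
  have hH2a := stepPos_KSCUPar_of_KSC₇Par P f c35 G b ιB C38 parA parH C37 (fun j => GAY (f j).toKIdx (parA j) (parBY (f j).toKIdx) (GpY (f j).toKIdx (parA j))) (fun j => parBY (f j).toKIdx)
    (CinvY P f G parA) hι hG1 hM₂ hrepr (d + 1)
    (stepH2Pos_KACU_frameParG_on P f c35 G b ιB C38 parA parH C37 hι hG1 M₂ hM₂ hrepr hcR Cq hCq hC37 MInv aInv aW hMInv haInv haW hparG hparC hunitG hunitXG hsym hunitA hb₁ C₀ hC₀ hreg335P hC37G cVar hcVar hvarB hMd mN hnbr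
      d261 h261)
  have hLa := stepPos_KSCUPar_of_KSC₇Par P f c35 G b ιB C38 parA parH C37 (fun j => GAY (f j).toKIdx (parA j) (parBY (f j).toKIdx) (GpY (f j).toKIdx (parA j))) (fun j => parBY (f j).toKIdx)
    (CinvY P f G parA) hι hG1 hM₂ hrepr (d + 1)
    (stepL2Pos_KACU_frameParG_on P f c35 G b ιB C38 parA parH C37 hι hG1 M₂ hM₂ hrepr hcR Cq hCq hC37 MInv aInv aW hMInv haInv haW hparG hparC hunitG hunitXG hsym hunitA hb₁ C₀ hC₀ hreg335P hC37G cVar hcVar hvarB hMd mN hnbr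
      d261 h261)
  -- the G′ side: the eight members of the two-transporter reading `KSCUPar parA parH`
  exact sectBStepPrinted_of_posBlockSteps (fun j => modelSignsOn_geo9K (f j).toKIdx)
    (thm32Printed_codedU P f c35 G C38 C37 _ (d + 1) h32) h33
    (stepAnalyticPos_KSCUParG_on P f c35 G parA parH (fun j => GAY (f j).toKIdx (parA j) (parBY (f j).toKIdx) (GpY (f j).toKIdx (parA j)))
      (fun j => parBY (f j).toKIdx) b ιB C37 C38 _ hι hG1 (d + 1) M₂ hM₂ hrepr hcR Cq hCq hC37 MInv aInv aW hMInv haInv haW hparG hparC hunitG)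
    (stepEPos_KSCUParG_on P f c35 G parA parH (fun j => GAY (f j).toKIdx (parA j) (parBY (f j).toKIdx) (GpY (f j).toKIdx (parA j)))
      (fun j => parBY (f j).toKIdx) b ιB C37 C38 _ hι hG1 (d + 1) M₂ hM₂ hrepr hcR Cq hCq hC37 MInv aInv aW hMInv haInv haW hparG hparC hunitG)
    (stepL2Pos_KSCUParG_on P f c35 G b C37 C38 parA parH (fun j => GAY (f j).toKIdx (parA j) (parBY (f j).toKIdx) (GpY (f j).toKIdx (parA j)))
      (fun j => parBY (f j).toKIdx) ιB _ hι hG1 (d + 1) M₂ hM₂ hrepr hcR hcL Cq hCq hC37 MInv aInv aW hMInv haInv haW hparG hparC hunitG hcP hplaq)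
    (stepGlobPos_KSCUParG_on P f c35 G parA parH (fun j => GAY (f j).toKIdx (parA j) (parBY (f j).toKIdx) (GpY (f j).toKIdx (parA j)))
      (fun j => parBY (f j).toKIdx) b ιB C37 C38 _ hι hG1 (d + 1) M₂ hM₂ hrepr hcR Cq hCq hC37 MInv aInv aW hMInv haInv haW hparG hparC hunitG)
    (stepH1Pos_KSCUParG_on P f c35 G parA parH (fun j => GAY (f j).toKIdx (parA j) (parBY (f j).toKIdx) (GpY (f j).toKIdx (parA j)))
      (fun j => parBY (f j).toKIdx) b ιB C37 C38 _ hι hG1 hparH (d + 1) M₂ hM₂ hrepr hcR Cq hCq hC37 MInv aInv aW hMInv haInv haW hparG hparC hunitG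
      hcLip hLip)
    (stepE4Pos_KSCUParG_on P f c35 G parA parH (fun j => GAY (f j).toKIdx (parA j) (parBY (f j).toKIdx) (GpY (f j).toKIdx (parA j)))
      (fun j => parBY (f j).toKIdx) b ιB C37 C38 _ hι hG1 (d + 1) M₂ hM₂ hrepr hcR Cq hCq hC37 MInv aInv aW hMInv haInv haW hparG hparC hunitG)
    (stepH2Pos_KSCUParG_on P f c35 G parA parH (fun j => GAY (f j).toKIdx (parA j) (parBY (f j).toKIdx) (GpY (f j).toKIdx (parA j)))
      (fun j => parBY (f j).toKIdx) b ιB C37 C38 _ hι hG1 (d + 1) M₂ hM₂ hrepr hcR Cq hCq hC37 MInv aInv aW hMInv haInv haW hparG hparC hunitG)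
    (stepKerPos_KSCUParG_on P f c35 G parA parH (fun j => GAY (f j).toKIdx (parA j) (parBY (f j).toKIdx) (GpY (f j).toKIdx (parA j)))
      (fun j => parBY (f j).toKIdx) b ιB C37 C38 hι hG1 M₂ hM₂ hrepr hcR Cq hCq hC37 MInv aInv aW hMInv haInv haW hparG hparC hunitG hunitXG hsym)
    hEa hLa hGa hH1a hE4a hH2a

/-- ★★ **THEOREM 3.4 OF RECORD WITH THE TWO TRANSPORTERS, `Thm34UPar`, on the subfamily** — «Thus Theorem 3.4 is proved, assuming that Theorems 3.1–3.3 hold» (p.407):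
`B9.thm34_of_sectB` on `sectBStepUParG_of_members` and the Theorems 3.2 ∕ 3.3 over the coded carrier; same binders.
[cite: Balaban1985BackgroundPropagators, Thm 3.4 p.400, Sect. B p.407, Thms 3.2–3.3 pp.398–399] -/
theorem thm34UParG_of_members (hι : ∀ (j : J) (s : BlkY (f j).toKIdx), β (f j).toKIdx.hN (f j).toKIdx.D (f j).toKIdx.hk (ιB j s) = s)
    (hG1 : ∀ u : 𝔸ˣ, u ∈ G → ‖(u : 𝔸)‖ ≤ 1)
    (hparH : ∀ j (U : CfgY 𝔸 (f j).toKIdx), GVal G (f j).toKIdx U → ∀ z w, parH j U z w ∈ G)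
    (M₂ : ℝ) (hM₂ : 0 ≤ M₂) (hrepr : ∀ (v : 𝔸) (j : ι), |b.repr v j| ≤ M₂ * ‖v‖) (hcR : 0 < M₂ * ∑ j, ‖b j‖)
    (hcL : 0 < Real.sqrt (Fintype.card ι) * M₂ * ∑ j, ‖b j‖)
    (Cq : ℝ) (hCq : 0 ≤ Cq)
    (hC37 : ∀ j β' U a, C37 j β' U a → GVal G (f j).toKIdx U ∧ CplxLettersY G (f j) (parA j) (ιB j) Cq β' U a)
    (MInv aInv aW : ℝ) (hMInv : 0 < MInv) (haInv : 0 < aInv) (haW : 0 < aW)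
    (hparG : ∀ j (α₀ : ℝ) (U : CfgY 𝔸 (f j).toKIdx), MInv ≤ (geo9Y (f j)).M → 0 < α₀ → (geo9Y (f j)).M * α₀ ≤ aInv →
      (bg9YC 𝔸 G P (f j)).Reg335 c35 α₀ U → ∀ z w, parA j U z w ∈ G)
    (hparC : ∀ j β' U a, C37 j β' U a → ∀ z w, parA j U z w ∈ G)
    (hunitG : ∀ j (α₀ : ℝ) (U : CfgY 𝔸 (f j).toKIdx), MInv ≤ (geo9Y (f j)).M → 0 < α₀ → (geo9Y (f j)).M * α₀ ≤ aInv →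
      (bg9YC 𝔸 G P (f j)).Reg335 c35 α₀ U → IsUnit (deltaPrimeAY (f j).toKIdx (parA j) U))
    (hunitXG : ∀ j (α₀ : ℝ) (U : CfgY 𝔸 (f j).toKIdx), MInv ≤ (geo9Y (f j)).M → 0 < α₀ → (geo9Y (f j)).M * α₀ ≤ aInv →
      (bg9YC 𝔸 G P (f j)).Reg335 c35 α₀ U → IsUnit (XY (f j).toKIdx (parA j) (GpY (f j).toKIdx (parA j)) U))
    (hsym : ∀ j (U : CfgY 𝔸 (f j).toKIdx) (z w : SiteY (f j).toKIdx), parA j U z w = (parA j U w z)⁻¹)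
    (hunitA : ∀ j (α₀ : ℝ) (U : CfgY 𝔸 (f j).toKIdx), MInv ≤ (geo9Y (f j)).M → 0 < α₀ → (geo9Y (f j)).M * α₀ ≤ aInv →
      (bg9YC 𝔸 G P (f j)).Reg335 c35 α₀ U → IsUnit (deltaAY (f j).toKIdx (parA j) (parBY (f j).toKIdx) (GpY (f j).toKIdx (parA j)) U)) (hb₁ : 0 ≤ b₁)
    (C₀ : ℝ) (hC₀ : 0 ≤ C₀)
    (hreg335P : ∀ j (α₀ : ℝ) (U : CfgY 𝔸 (f j).toKIdx), MInv ≤ (geo9Y (f j)).M → 0 < α₀ → (geo9Y (f j)).M * α₀ ≤ aInv →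
      (bg9YC 𝔸 G P (f j)).Reg335 c35 α₀ U → Reg335PlaqY G (f j) (ιB j) C₀ U)
    (hC37G : ∀ j β' U a, C37 j β' U a → CplxLettersGY G (f j) (ιB j) β' U a)
    (cVar : ℝ) (hcVar : 0 ≤ cVar) (hvarB : ∀ j β' U a, C37 j β' U a → VarParBY (f j).toKIdx (parBY (f j).toKIdx) cVar β' U a)
    (hMd : 2 * ((d : ℝ) + 1) < MInv) (mN : ℕ) (hnbr : ∀ (j : J) (y' : IBondY (f j).toKIdx), (nbr (geo9Y (f j)) (2 * ((d : ℝ) + 1)) y').card ≤ mN)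
    (hMr : rLB d ℓ + 1 < MInv)
    {cLip : ℝ} (hcLip : 0 ≤ cLip)
    (hLip : ∀ (j : J) (α₀ : ℝ) (U : CfgY 𝔸 (f j).toKIdx), (bg9YC 𝔸 G P (f j)).Reg335 c35 α₀ U → HolderLipY (f j).toKIdx cLip (parH j U) U)
    {cP : ℝ} (hcP : 0 ≤ cP)
    (hplaq : ∀ (j : J) (α₀ : ℝ) (U : CfgY 𝔸 (f j).toKIdx), MInv ≤ (geo9Y (f j)).M → 0 < α₀ → (geo9Y (f j)).M * α₀ ≤ aInv →
      (bg9YC 𝔸 G P (f j)).Reg335 c35 α₀ U → PlaqLawY (f j) (ιB j) cP U)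
    (d261 : ℝ → ℕ)
    (h261 : ∀ (j : J) (δ α : ℝ), 0 < δ → δ ≤ 1 → 9 / 5000 ≤ α → α < 1 →
      (gFrame₅CodedOnSel P f c35 G parA (fun j => parBY (f j).toKIdx) b ιB C37 C38 hι hG1 M₂ hM₂ hrepr hcR Cq hCq hC37 MInv aInv aW hMInv haInv haW hparG hparC hunitG
        hunitXG hsym hunitA (hparB_parBY f G) hb₁ C₀ hC₀ hreg335P hC37G cVar hcVar hvarB hMd mN hnbr).M261 δ ≤ (geo9Y (f j)).M →
      Ineq261 (d261 δ) (toB6 (geo9Y (f j)) 0 True) δ α)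
    (h32 : B9.Thm32Printed (d + 1) c35 (fun j => geo9Y (f j)) (fun j => bg9YC 𝔸 G P (f j)) (CinvY P f G parA))
    (h33 : B9.Thm33Printed c35 (fun j => geo9Y (f j)) (fun j => (codingYx P G (f j) (C37 j) (C38 j)).bg)
      (fun j => KSCUPar P G (f j) (parA j) (parH j) (C37 j) (C38 j))
      (fun j => KACU P G (f j) (GAY (f j).toKIdx (parA j) (parBY (f j).toKIdx) (GpY (f j).toKIdx (parA j))) (parBY (f j).toKIdx) (C37 j) (C38 j))) :
    Thm34UPar P f c35 G b parA parH (fun j => GAY (f j).toKIdx (parA j) (parBY (f j).toKIdx) (GpY (f j).toKIdx (parA j))) (fun j => parBY (f j).toKIdx) C37 C38 :=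
  B9.thm34_of_sectB (d + 1) c35 (fun j => geo9Y (f j)) (fun j => (codingYx P G (f j) (C37 j) (C38 j)).bg)
    (fun j => KSCUPar P G (f j) (parA j) (parH j) (C37 j) (C38 j))
    (fun j => KACU P G (f j) (GAY (f j).toKIdx (parA j) (parBY (f j).toKIdx) (GpY (f j).toKIdx (parA j))) (parBY (f j).toKIdx) (C37 j) (C38 j))
    (fun j => pullS (codingYx P G (f j) (C37 j) (C38 j)) (CinvY P f G parA j)) (fun j => IsAnKY P G (f j) (parA j) b (C37 j) (C38 j))
    (sectBStepUParG_of_members P f c35 G b ιB C38 parA parH C37 hι hG1 hparH M₂ hM₂ hrepr hcR hcL Cq hCq hC37 MInv aInv aW hMInv haInv haW hparG hparC hunitG hunitXG hsym hunitA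
      hb₁ C₀ hC₀ hreg335P hC37G cVar hcVar hvarB hMd mN hnbr hMr hcLip hLip hcP hplaq d261 h261 h32 h33)
    (thm32Printed_codedU P f c35 G C38 C37 _ (d + 1) h32) h33

end Assembly

/-! ## §3 The Hölder transporter of record `parH := parSymY`: its two laws discharged -/

section HolderOfRecord

/-- ★★★ **`SectBStepUPar` AT THE HÖLDER TRANSPORTER OF RECORD `parH := parSymY` (print's shortest contours), its two laws DISCHARGED** (`hparH := Node00.parSymY_mem`,
`hLip := hLip_parSymY`, `c_Lip = d+1`): `sectBStepUParG_of_members` at `parH j := parSymY (f j).toKIdx`.  The AVERAGING transporter `parA` and its five laws `hparG∕hparC hunitG hunitXG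
hsym hunitA` stay displayed — the shape of dag-n06-d's displayed binder `hBK` at the knit instance `(parA, parH) := (parKnitY, parSymY)` (the parA-laws there are dag-n06-l's
K2 lemmas `symm0_parKnitY ∕ isUnit_deltaPrimeAY_parKnitY ∕ …`). [cite: Balaban1985BackgroundPropagators, Thm 3.4 p.400, Sect. B pp.400–407, (3.21) p.394, (3.40) p.397 («a shortest contour»), Thms 3.1–3.3 pp.397–399; Balaban1984PropagatorsII, Lemma 2.1 p.234, (2.51) p.232] -/
theorem sectBStepUParG_parSymYH_of_members (hι : ∀ (j : J) (s : BlkY (f j).toKIdx), β (f j).toKIdx.hN (f j).toKIdx.D (f j).toKIdx.hk (ιB j s) = s)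
    (hG1 : ∀ u : 𝔸ˣ, u ∈ G → ‖(u : 𝔸)‖ ≤ 1)
   
    (M₂ : ℝ) (hM₂ : 0 ≤ M₂) (hrepr : ∀ (v : 𝔸) (j : ι), |b.repr v j| ≤ M₂ * ‖v‖) (hcR : 0 < M₂ * ∑ j, ‖b j‖)
    (hcL : 0 < Real.sqrt (Fintype.card ι) * M₂ * ∑ j, ‖b j‖)
    (Cq : ℝ) (hCq : 0 ≤ Cq)
    (hC37 : ∀ j β' U a, C37 j β' U a → GVal G (f j).toKIdx U ∧ CplxLettersY G (f j) (parA j) (ιB j) Cq β' U a)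
    (MInv aInv aW : ℝ) (hMInv : 0 < MInv) (haInv : 0 < aInv) (haW : 0 < aW)
    (hparG : ∀ j (α₀ : ℝ) (U : CfgY 𝔸 (f j).toKIdx), MInv ≤ (geo9Y (f j)).M → 0 < α₀ → (geo9Y (f j)).M * α₀ ≤ aInv →
      (bg9YC 𝔸 G P (f j)).Reg335 c35 α₀ U → ∀ z w, parA j U z w ∈ G)
    (hparC : ∀ j β' U a, C37 j β' U a → ∀ z w, parA j U z w ∈ G)
    (hunitG : ∀ j (α₀ : ℝ) (U : CfgY 𝔸 (f j).toKIdx), MInv ≤ (geo9Y (f j)).M → 0 < α₀ → (geo9Y (f j)).M * α₀ ≤ aInv →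
      (bg9YC 𝔸 G P (f j)).Reg335 c35 α₀ U → IsUnit (deltaPrimeAY (f j).toKIdx (parA j) U))
    (hunitXG : ∀ j (α₀ : ℝ) (U : CfgY 𝔸 (f j).toKIdx), MInv ≤ (geo9Y (f j)).M → 0 < α₀ → (geo9Y (f j)).M * α₀ ≤ aInv →
      (bg9YC 𝔸 G P (f j)).Reg335 c35 α₀ U → IsUnit (XY (f j).toKIdx (parA j) (GpY (f j).toKIdx (parA j)) U))
    (hsym : ∀ j (U : CfgY 𝔸 (f j).toKIdx) (z w : SiteY (f j).toKIdx), parA j U z w = (parA j U w z)⁻¹)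
    (hunitA : ∀ j (α₀ : ℝ) (U : CfgY 𝔸 (f j).toKIdx), MInv ≤ (geo9Y (f j)).M → 0 < α₀ → (geo9Y (f j)).M * α₀ ≤ aInv →
      (bg9YC 𝔸 G P (f j)).Reg335 c35 α₀ U → IsUnit (deltaAY (f j).toKIdx (parA j) (parBY (f j).toKIdx) (GpY (f j).toKIdx (parA j)) U)) (hb₁ : 0 ≤ b₁)
    (C₀ : ℝ) (hC₀ : 0 ≤ C₀)
    (hreg335P : ∀ j (α₀ : ℝ) (U : CfgY 𝔸 (f j).toKIdx), MInv ≤ (geo9Y (f j)).M → 0 < α₀ → (geo9Y (f j)).M * α₀ ≤ aInv →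
      (bg9YC 𝔸 G P (f j)).Reg335 c35 α₀ U → Reg335PlaqY G (f j) (ιB j) C₀ U)
    (hC37G : ∀ j β' U a, C37 j β' U a → CplxLettersGY G (f j) (ιB j) β' U a)
    (cVar : ℝ) (hcVar : 0 ≤ cVar) (hvarB : ∀ j β' U a, C37 j β' U a → VarParBY (f j).toKIdx (parBY (f j).toKIdx) cVar β' U a)
    (hMd : 2 * ((d : ℝ) + 1) < MInv) (mN : ℕ) (hnbr : ∀ (j : J) (y' : IBondY (f j).toKIdx), (nbr (geo9Y (f j)) (2 * ((d : ℝ) + 1)) y').card ≤ mN)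
    (hMr : rLB d ℓ + 1 < MInv) {cP : ℝ} (hcP : 0 ≤ cP)
    (hplaq : ∀ (j : J) (α₀ : ℝ) (U : CfgY 𝔸 (f j).toKIdx), MInv ≤ (geo9Y (f j)).M → 0 < α₀ → (geo9Y (f j)).M * α₀ ≤ aInv →
      (bg9YC 𝔸 G P (f j)).Reg335 c35 α₀ U → PlaqLawY (f j) (ιB j) cP U)
    (d261 : ℝ → ℕ)
    (h261 : ∀ (j : J) (δ α : ℝ), 0 < δ → δ ≤ 1 → 9 / 5000 ≤ α → α < 1 →
      (gFrame₅CodedOnSel P f c35 G parA (fun j => parBY (f j).toKIdx) b ιB C37 C38 hι hG1 M₂ hM₂ hrepr hcR Cq hCq hC37 MInv aInv aW hMInv haInv haW hparG hparC hunitG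
        hunitXG hsym hunitA (hparB_parBY f G) hb₁ C₀ hC₀ hreg335P hC37G cVar hcVar hvarB hMd mN hnbr).M261 δ ≤ (geo9Y (f j)).M →
      Ineq261 (d261 δ) (toB6 (geo9Y (f j)) 0 True) δ α)
    (h32 : B9.Thm32Printed (d + 1) c35 (fun j => geo9Y (f j)) (fun j => bg9YC 𝔸 G P (f j)) (CinvY P f G parA))
    (h33 : B9.Thm33Printed c35 (fun j => geo9Y (f j)) (fun j => (codingYx P G (f j) (C37 j) (C38 j)).bg)
      (fun j => KSCUPar P G (f j) (parA j) (parSymY (f j).toKIdx) (C37 j) (C38 j))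
      (fun j => KACU P G (f j) (GAY (f j).toKIdx (parA j) (parBY (f j).toKIdx) (GpY (f j).toKIdx (parA j))) (parBY (f j).toKIdx) (C37 j) (C38 j))) :
    SectBStepUPar P f (d + 1) c35 G b parA (fun j => parSymY (f j).toKIdx) (fun j => GAY (f j).toKIdx (parA j) (parBY (f j).toKIdx) (GpY (f j).toKIdx (parA j)))
      (fun j => parBY (f j).toKIdx) C37 C38 (CinvY P f G parA) :=
  sectBStepUParG_of_members P f c35 G b ιB C38 parA (fun j => parSymY (f j).toKIdx) C37 hι hG1 (fun j _ hU z w => parSymY_mem (f j).toKIdx hU z w) M₂ hM₂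
    hrepr hcR hcL Cq hCq hC37 MInv aInv aW hMInv haInv haW hparG hparC hunitG hunitXG hsym hunitA hb₁ C₀ hC₀ hreg335P hC37G cVar hcVar hvarB hMd mN hnbr hMr
    (by positivity : (0 : ℝ) ≤ (d : ℝ) + 1) (hLip_parSymY P f c35 G hG1) hcP hplaq d261 h261 h32 h33

end HolderOfRecord

end Literature.MathematicalPhysics.QuantumFieldTheory.Balaban1983to89.B9SectBStepUParGOfMembers

end
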